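import Summits.Ventures.LatticeQCDFlow.Scaling.PlaquetteCorrelatorFloor

/-!
HONEST FRAMING: exact (Metropolis-corrected) sampling algorithms for lattice gauge theory; figures
of merit are autocorrelation/cost numbers at stated couplings and volumes; no continuum-physics
claim.

# TemporalPlaquetteLogConvex — REFLECTION POSITIVITY FOR THE CORRELATOR OF A TEMPORAL PLAQUETTE
# ALONG AN IN-PLANE AXIS: THE SCHWARZ INEQUALITIES (lean-1 GEN-12, ours; part 1 of 3 of the
# in-plane half of the clustering-floor structure theorem)

Venture-side (OURS). Cell `lqcd-flow` (pub-lqcd), unit `pub-lqcd-lean-1-g12`, 2026-08-23.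

GEN-11 (`PlaquetteCorrelator{RP,LogConvex,Floor}`, `ClusteringFloor*`, `CrossCutFloor*`) treated
the truncated correlator of two parallel plaquettes separated along an axis TRANSVERSE to their
plane (after an axis permutation: spatial plaquettes `i, j ≠ 0` separated in time).  The IN-PLANE
case — plaquettes in the `(i, j)` plane separated along `a ∈ {i, j}` — is, after the same
permutation, the truncated temporal correlator
`G(m) = ⟨P_0 P_m⟩ − ⟨P_0⟩⟨P_m⟩` (`PlaquetteCorrelatorRP.tCorr ρ β x 0 j m`) of a TEMPORAL plaquette
`P = Re tr ρ(U_{(x; 0, j)})`, `j ≠ 0`, with its translates by `m` time units.  Such a plaquette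
occupies the two time slices `m, m + 1`, so under the tree's reflections it maps to the conjugate
inverse holonomy of a plaquette based one slice further away (Literature `WilsonRP.plaqRe_timeReflect`,
`WilsonSiteRP.plaqRe_negReflect`):

* §1 `P_m ∘ Θ = P_{−m}` (links, `t ↦ 1 − t`) and `P_m ∘ Θ' = P_{−m−1}` (sites, `t ↦ −t`); the support
  of `P_m` (links of times `m`, `m + 1`);
* §2 the admissible ranges: `P_m − c` is a positive-time observable for `1 ≤ m`, `m + 1 ≤ L/2`
  (links, even torus), `1 ≤ m ≤ L/2` (mixed reflection, odd torus `L ≥ 3`), `m + 1 ≤ L/2` (sites,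
  even torus);
* §3 the Schwarz inequalities of the reflection form (Literature
  `FariaDaVeigaOCarroll2022.MultiReflection.sq_integral_mul_comp_le_of_rp`):
  **`G(s+t)² ≤ G(2s)·G(2t)`** (links: `1 ≤ s, t`, `s+1, t+1 ≤ L/2`, `L` even, `β ≥ 0`; mixed:
  `1 ≤ s, t ≤ L/2`, `L ≥ 3` odd, `β ≥ 0`) and **`G(s+t+1)² ≤ G(2s+1)·G(2t+1)`** (sites:
  `s+1, t+1 ≤ L/2`, `L` even, every real `β`);
(the diagonal terms `0 ≤ G(2m)`, `0 ≤ G(2m+1)` and the log-convexity are the sequel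
`TemporalPlaquetteFloor`).

Compared with the transverse case the parities are SWAPPED (links give even separations, sites odd
ones) and the inequality `G(1)² ≤ G(0)·G(2)` is NOT an instance (a temporal plaquette based in the
slice `0` straddles the link hyperplane): the sequel `TemporalPlaquetteFloor` derives log-convexity
`G(n)² ≤ G(n−1)G(n+1)` for `2 ≤ n ≤ L − 2` only, which is why the in-plane structure theorem
(`ClusteringFloorInPlane`) needs a floor at an in-plane separation `≥ 2`.
NOT CLAIMED: `β < 0` for the link forms; anything at separation pattern `(0, 1, 2)`.  Literature
grade (cell rule): known mechanism (Osterwalder–Seiler reflection positivity ⇒ Schwarz inequality;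
Seiler LNP 159 Ch. 2, Glimm–Jaffe §6); new typing for temporal plaquettes on finite tori of both
parities, no new theorem of physics.
-/

noncomputable section

namespace Summit.Ventures.LatticeQCDFlow.Theory2.Clustering

open MeasureTheory Literature.MathematicalPhysics.QuantumFieldTheory
open Literature.MathematicalPhysics.QuantumFieldTheory.FariaDaVeigaOCarroll2022
open Literature.MathematicalPhysics.QuantumFieldTheory.FariaDaVeigaOCarroll2022.MultiReflection

section Temporal

variable {d L N : ℕ} [NeZero d] [NeZero L] {G : Type*} [Group G] [TopologicalSpace G]
  [IsTopologicalGroup G] [CompactSpace G] [MeasurableSpace G] [BorelSpace G]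
  [SecondCountableTopology G] (ρ : G →* Matrix (Fin N) (Fin N) ℂ)

/-! ## §1 Temporal plaquettes under the two reflections; support -/

omit [NeZero L] [Group G] [TopologicalSpace G] [IsTopologicalGroup G] [CompactSpace G]
  [MeasurableSpace G] [BorelSpace G] [SecondCountableTopology G] ρ in
/-- The time shift of a time translate: `(x + m e₀) + e₀ = x + (m + 1) e₀`. [folklore] -/
theorem add_single_shift_zero (x : Site d L) (m : ZMod L) :
    (x + Pi.single (0 : Fin d) m : Site d L).shift 0 = x + Pi.single (0 : Fin d) (m + 1) := by
  rw [Site.shift, add_assoc, ← Pi.single_add]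

omit [NeZero L] [MeasurableSpace G] [BorelSpace G] [SecondCountableTopology G] in
/-- **Temporal plaquettes under the link reflection `Θ` (`t ↦ 1 − t`)**: `P_m ∘ Θ = P_{−m}` for
the timed family of the temporal plaquette `(x; 0, j)`, `x 0 = 0`, `j ≠ 0` (the plaquette of slices
`m, m+1` goes to the conjugate inverse holonomy of the plaquette of slices `−m, −m+1`; Literature
`WilsonRP.plaqRe_timeReflect`). -/
theorem tObs_timeReflect_temporal (hρ : Continuous ρ) {x : Site d L} (hx : x 0 = 0) {j : Fin d}
    (hj : j ≠ 0) (m : ZMod L) (U : GaugeConfig d L G) :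
    tObs ρ x 0 j m U.timeReflect = tObs ρ x 0 j (-m) U := by
  have hj' : (0 : Fin d) < j := (Fin.pos_iff_ne_zero' j).2 hj
  have h := WilsonRP.plaqRe_timeReflect ρ hρ U
    ((x + Pi.single (0 : Fin d) m : Site d L), ⟨((0 : Fin d), j), hj'⟩)
  unfold WilsonRP.plaqRe WilsonRP.plaqReflect at h
  simp only [↓reduceIte] at h
  have e : (1 : ZMod L) - (m + 1) = -m := by ring
  unfold tObs
  rw [h, add_single_shift_zero, timeReflect_add_single hx, e]

omit [NeZero L] [MeasurableSpace G] [BorelSpace G] [SecondCountableTopology G] in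
/-- **Temporal plaquettes under the site reflection `Θ'` (`t ↦ −t`)**: `P_m ∘ Θ' = P_{−m−1}`
(Literature `WilsonSiteRP.plaqRe_negReflect`). -/
theorem tObs_negReflect_temporal (hρ : Continuous ρ) {x : Site d L} (hx : x 0 = 0) {j : Fin d}
    (hj : j ≠ 0) (m : ZMod L) (U : GaugeConfig d L G) :
    tObs ρ x 0 j m U.negReflect = tObs ρ x 0 j (-m - 1) U := by
  have hj' : (0 : Fin d) < j := (Fin.pos_iff_ne_zero' j).2 hj
  have h := WilsonSiteRP.plaqRe_negReflect ρ hρ U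
    ((x + Pi.single (0 : Fin d) m : Site d L), ⟨((0 : Fin d), j), hj'⟩)
  unfold WilsonRP.plaqRe WilsonSiteRP.sitePlaqReflect at h
  simp only [↓reduceIte] at h
  have e : -(m + 1 : ZMod L) = -m - 1 := by ring
  unfold tObs
  rw [h, add_single_shift_zero, negReflect_add_single hx, e]

omit [NeZero L] [TopologicalSpace G] [IsTopologicalGroup G] [CompactSpace G] [MeasurableSpace G]
  [BorelSpace G] [SecondCountableTopology G] in
/-- **Support of a temporal plaquette**: the observable at `(y; 0, j)`, `j ≠ 0`, depends only on the
links of time `y 0` (its two temporal links and its lower spatial link) and on the spatial links of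
time `y 0 + 1` (its upper spatial link). -/
theorem plaqObs_eq_of_agree_temporal {y : Site d L} {j : Fin d} (hj : j ≠ 0)
    {U V : GaugeConfig d L G}
    (h : ∀ e : Edge d L, (e.1 0 = y 0 ∨ (e.2 ≠ 0 ∧ e.1 0 = y 0 + 1)) → U e = V e) :
    (ρ (plaquetteHolonomy U y 0 j)).trace.re = (ρ (plaquetteHolonomy V y 0 j)).trace.re := by
  have h1 : U (y, 0) = V (y, 0) := h _ (Or.inl rfl)
  have h2 : U (y.shift 0, j) = V (y.shift 0, j) :=
    h _ (Or.inr ⟨hj, WilsonRP.shift_apply_self y 0⟩)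
  have h3 : U (y.shift j, 0) = V (y.shift j, 0) := h _ (Or.inl (shift_apply_zero_of_ne y hj))
  have h4 : U (y, j) = V (y, j) := h _ (Or.inl rfl)
  simp only [plaquetteHolonomy, h1, h2, h3, h4]

/-- Measurability, boundedness and support of the centred timed temporal observable. -/
theorem centred_Pobs_props_temporal (hρ : Continuous ρ) (x : Site d L) {j : Fin d} (hj : j ≠ 0)
    (m : ZMod L) (c : ℝ) :
    Measurable (fun U : GaugeConfig d L G => tObs ρ x 0 j m U - c)
      ∧ (∃ K : ℝ, ∀ U : GaugeConfig d L G, |tObs ρ x 0 j m U - c| ≤ K)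
      ∧ DependsOn (fun U : GaugeConfig d L G => tObs ρ x 0 j m U - c)
          {e : Edge d L | e.1 0 = (x + Pi.single (0 : Fin d) m : Site d L) 0 ∨
            (e.2 ≠ 0 ∧ e.1 0 = (x + Pi.single (0 : Fin d) m : Site d L) 0 + 1)} := by
  unfold tObs
  refine ⟨((continuous_plaqObs ρ hρ _ 0 j).sub continuous_const).measurable,
    ⟨N + |c|, fun U => ?_⟩, fun U V hUV => ?_⟩
  · have h' := abs_le.1 (abs_plaqObs_le ρ hρ U (x + Pi.single (0 : Fin d) m) 0 j)
    exact abs_le.2 ⟨by linarith [h'.1, neg_abs_le c, le_abs_self c],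
      by linarith [h'.2, neg_abs_le c, le_abs_self c]⟩
  · simp only [sub_left_inj]
    exact plaqObs_eq_of_agree_temporal ρ hj fun e he => hUV e he

/-! ## §2 Admissible ranges: when `P_m − c` is a positive-time observable -/

/-- **Links, even torus**: for `1 ≤ m`, `m + 1 ≤ L/2` the centred temporal observable depends only
on positive-time links (`WilsonRP.IsPosEdge`: both endpoints in `1 ≤ t ≤ L/2`). -/
theorem dependsOn_isPosEdge_temporal (hρ : Continuous ρ) {x : Site d L} (hx : x 0 = 0) {j : Fin d}
    (hj : j ≠ 0) (c : ℝ) {m : ℕ} (hm1 : 1 ≤ m) (hm : m + 1 ≤ L / 2) :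
    DependsOn (fun U : GaugeConfig d L G => tObs ρ x 0 j (m : ZMod L) U - c)
      {e : Edge d L | WilsonRP.IsPosEdge e} := by
  haveI : Fact (1 < L) := ⟨by omega⟩
  intro U V hUV
  refine (centred_Pobs_props_temporal ρ hρ x hj (m : ZMod L) c).2.2 fun e he => hUV e ?_
  rw [add_single_apply_zero hx] at he
  show WilsonRP.IsPosEdge e
  rw [WilsonRP.isPosEdge_iff]
  rcases he with he1 | ⟨he2, he1⟩
  · have hv : (e.1 0).val = m := by
      rw [he1, ZMod.val_natCast, Nat.mod_eq_of_lt (by omega)]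
    rw [hv]
    refine ⟨hm1, ?_⟩
    split_ifs <;> omega
  · have hv : (e.1 0).val = m + 1 := by
      rw [he1, ← Nat.cast_succ, ZMod.val_natCast, Nat.mod_eq_of_lt (by omega)]
    rw [hv, if_neg he2]
    omega

/-- **Mixed reflection, odd torus** (`L ≥ 3`): for `1 ≤ m ≤ L/2` the centred temporal observable
depends only on the links `P ∪ M` of the closed half `{1 ≤ t ≤ L/2 + 1}` (the upper spatial link of
`P_{L/2}` lies in the site hyperplane `t = L/2 + 1`). -/
theorem dependsOn_odd_temporal (hL3 : 3 ≤ L) (hρ : Continuous ρ) {x : Site d L} (hx : x 0 = 0)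
    {j : Fin d} (hj : j ≠ 0) (c : ℝ) {m : ℕ} (hm1 : 1 ≤ m) (hm : m ≤ L / 2) :
    DependsOn (fun U : GaugeConfig d L G => tObs ρ x 0 j (m : ZMod L) U - c)
      ((WilsonOddRP.oPosEdges ∪ WilsonOddRP.oSharedEdges : Finset (Edge d L)) : Set (Edge d L)) := by
  intro U V hUV
  refine (centred_Pobs_props_temporal ρ hρ x hj (m : ZMod L) c).2.2 fun e he => hUV e ?_
  rw [add_single_apply_zero hx] at he
  rw [Finset.coe_union, Set.mem_union, Finset.mem_coe, Finset.mem_coe, WilsonOddRP.mem_oPosEdges,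
    WilsonOddRP.mem_oSharedEdges]
  rcases he with he1 | ⟨he2, he1⟩
  · have hv : (e.1 0).val = m := by
      rw [he1, ZMod.val_natCast, Nat.mod_eq_of_lt (by omega)]
    left
    show 1 ≤ (e.1 0).val ∧ (e.1 0).val ≤ L / 2
    rw [hv]
    exact ⟨hm1, hm⟩
  · have hv : (e.1 0).val = m + 1 := by
      rw [he1, ← Nat.cast_succ, ZMod.val_natCast, Nat.mod_eq_of_lt (by omega)]
    rcases Nat.lt_or_ge m (L / 2) with hlt | hge
    · left
      show 1 ≤ (e.1 0).val ∧ (e.1 0).val ≤ L / 2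
      rw [hv]
      exact ⟨by omega, by omega⟩
    · right
      show e.2 ≠ 0 ∧ (e.1 0).val = L / 2 + 1
      rw [hv]
      exact ⟨he2, by omega⟩

/-- **Sites, even torus**: for `m + 1 ≤ L/2` the centred temporal observable depends only on the
links `P' ∪ M'` of the closed slab `0 ≤ t ≤ L/2` (temporal links based at `t < L/2`, spatial links of
`1 ≤ t < L/2`, and the shared spatial links of the slices `t = 0`, `t = L/2`). -/
theorem dependsOn_site_temporal (hρ : Continuous ρ) {x : Site d L} (hx : x 0 = 0) {j : Fin d}
    (hj : j ≠ 0) (c : ℝ) {m : ℕ} (hm : m + 1 ≤ L / 2) :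
    DependsOn (fun U : GaugeConfig d L G => tObs ρ x 0 j (m : ZMod L) U - c)
      ((WilsonSiteRP.sitePosEdges ∪ WilsonSiteRP.sharedEdges : Finset (Edge d L)) :
        Set (Edge d L)) := by
  intro U V hUV
  refine (centred_Pobs_props_temporal ρ hρ x hj (m : ZMod L) c).2.2 fun e he => hUV e ?_
  rw [add_single_apply_zero hx] at he
  rw [Finset.coe_union, Set.mem_union, Finset.mem_coe, Finset.mem_coe, WilsonSiteRP.mem_sitePosEdges,
    WilsonSiteRP.mem_sharedEdges]
  rcases he with he1 | ⟨he2, he1⟩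
  · have hv : (e.1 0).val = m := by
      rw [he1, ZMod.val_natCast, Nat.mod_eq_of_lt (by omega)]
    by_cases h2 : e.2 = 0
    · left
      show (if e.2 = 0 then (e.1 0).val < L / 2 else 1 ≤ (e.1 0).val ∧ (e.1 0).val < L / 2)
      rw [if_pos h2, hv]
      omega
    · by_cases h0 : m = 0
      · right
        show e.2 ≠ 0 ∧ ((e.1 0).val = 0 ∨ (e.1 0).val = L / 2)
        rw [hv]
        exact ⟨h2, Or.inl h0⟩
      · left
        show (if e.2 = 0 then (e.1 0).val < L / 2 else 1 ≤ (e.1 0).val ∧ (e.1 0).val < L / 2)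
        rw [if_neg h2, hv]
        exact ⟨by omega, by omega⟩
  · have hv : (e.1 0).val = m + 1 := by
      rw [he1, ← Nat.cast_succ, ZMod.val_natCast, Nat.mod_eq_of_lt (by omega)]
    rcases Nat.lt_or_ge (m + 1) (L / 2) with hlt | hge
    · left
      show (if e.2 = 0 then (e.1 0).val < L / 2 else 1 ≤ (e.1 0).val ∧ (e.1 0).val < L / 2)
      rw [if_neg he2, hv]
      exact ⟨by omega, hlt⟩
    · right
      show e.2 ≠ 0 ∧ ((e.1 0).val = 0 ∨ (e.1 0).val = L / 2)
      rw [hv]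
      exact ⟨he2, Or.inr (by omega)⟩

/-! ## §3 The three Schwarz inequalities for the temporal family -/

/-- The reflection forms of the temporal family: `∫ (P_m − c)(P_{m'} ∘ Θ − c) dμ_β = G(m + m')`
(`c` the common mean). -/
theorem integral_centred_timeReflect_temporal (hρ : Continuous ρ) (β : ℝ) {x : Site d L}
    (hx : x 0 = 0) {j : Fin d} (hj : j ≠ 0) (m m' : ZMod L) :
    ∫ U, (tObs ρ x 0 j m U - wilsonExpectation ρ β (tObs ρ x 0 j 0))
        * (tObs ρ x 0 j m' U.timeReflect - wilsonExpectation ρ β (tObs ρ x 0 j 0))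
        ∂(wilsonMeasure ρ β)
      = tCorr ρ β x 0 j (m + m') := by
  simp_rw [tObs_timeReflect_temporal ρ hρ hx hj]
  rw [integral_centred_Pobs ρ hρ β x 0 j m (-m'), show -m' - m = -(m + m') by ring, corr_neg]

/-- `∫ (P_m − c)(P_{m'} ∘ Θ' − c) dμ_β = G(m + m' + 1)`. -/
theorem integral_centred_negReflect_temporal (hρ : Continuous ρ) (β : ℝ) {x : Site d L}
    (hx : x 0 = 0) {j : Fin d} (hj : j ≠ 0) (m m' : ZMod L) :
    ∫ U, (tObs ρ x 0 j m U - wilsonExpectation ρ β (tObs ρ x 0 j 0))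
        * (tObs ρ x 0 j m' U.negReflect - wilsonExpectation ρ β (tObs ρ x 0 j 0))
        ∂(wilsonMeasure ρ β)
      = tCorr ρ β x 0 j (m + m' + 1) := by
  simp_rw [tObs_negReflect_temporal ρ hρ hx hj]
  rw [integral_centred_Pobs ρ hρ β x 0 j m (-m' - 1), show -m' - 1 - m = -(m + m' + 1) by ring,
    corr_neg]

/-- **LINK REFLECTION, EVEN TORUS**: for `β ≥ 0`, a time-zero base site, `j ≠ 0` and
`1 ≤ s, t` with `s + 1, t + 1 ≤ L/2`: `G(s + t)² ≤ G(2t) · G(2s)`. -/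
theorem sq_tCorr_le_link_temporal (hL : Even L) (hρ : Continuous ρ) {β : ℝ} (hβ : 0 ≤ β)
    {x : Site d L} (hx : x 0 = 0) {j : Fin d} (hj : j ≠ 0) {s t : ℕ} (hs1 : 1 ≤ s)
    (hs : s + 1 ≤ L / 2) (ht1 : 1 ≤ t) (ht : t + 1 ≤ L / 2) :
    (tCorr ρ β x 0 j (((s + t : ℕ) : ZMod L))) ^ 2
      ≤ tCorr ρ β x 0 j (((2 * t : ℕ) : ZMod L)) * tCorr ρ β x 0 j (((2 * s : ℕ) : ZMod L)) := by
  haveI := isProbabilityMeasure_wilsonMeasure (d := d) (L := L) ρ hρ β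
  haveI : Fact (1 < L) := ⟨by omega⟩
  set c := wilsonExpectation ρ β (tObs ρ x 0 j 0) with hc
  have hadm : ∀ (A B : GaugeConfig d L G → ℝ) (r : ℝ),
      DependsOn A {e : Edge d L | WilsonRP.IsPosEdge e} →
      DependsOn B {e : Edge d L | WilsonRP.IsPosEdge e} →
      DependsOn (fun U => A U + r * B U) {e : Edge d L | WilsonRP.IsPosEdge e} :=
    fun A B r hA hB U V hUV => by simp only [hA hUV, hB hUV]
  obtain ⟨hAm, hAb, -⟩ := centred_Pobs_props_temporal ρ hρ x hj ((t : ℕ) : ZMod L) c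
  obtain ⟨hBm, hBb, -⟩ := centred_Pobs_props_temporal ρ hρ x hj ((s : ℕ) : ZMod L) c
  have key := sq_integral_mul_comp_le_of_rp (μ := wilsonMeasure ρ β) timeReflectEquiv
    (measurePreserving_timeReflectEquiv ρ hρ β)
    (fun U => (timeReflectEquiv (d := d) (L := L) (G := G)).left_inv U)
    (fun F => DependsOn F {e : Edge d L | WilsonRP.IsPosEdge e}) hadm
    (fun F hF hFm hFb => integral_mul_timeReflect_nonneg ρ hL hρ hβ hFm hFb hF)
    (dependsOn_isPosEdge_temporal ρ hρ hx hj c ht1 ht)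
    (dependsOn_isPosEdge_temporal ρ hρ hx hj c hs1 hs) hAm hBm hAb hBb
  have happ : ∀ U : GaugeConfig d L G,
      (timeReflectEquiv : GaugeConfig d L G ≃ᵐ GaugeConfig d L G) U = U.timeReflect := fun U => rfl
  simp_rw [happ] at key
  rw [integral_centred_timeReflect_temporal ρ hρ β hx hj,
    integral_centred_timeReflect_temporal ρ hρ β hx hj,
    integral_centred_timeReflect_temporal ρ hρ β hx hj] at key
  have e1 : ((t : ℕ) : ZMod L) + ((s : ℕ) : ZMod L) = (((s + t : ℕ) : ZMod L)) := by push_cast; ring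
  have e2 : ((t : ℕ) : ZMod L) + ((t : ℕ) : ZMod L) = (((2 * t : ℕ) : ZMod L)) := by push_cast; ring
  have e3 : ((s : ℕ) : ZMod L) + ((s : ℕ) : ZMod L) = (((2 * s : ℕ) : ZMod L)) := by push_cast; ring
  rw [e1, e2, e3] at key
  exact key

/-- **MIXED REFLECTION, ODD TORUS**: for `L` odd, `L ≥ 3`, `β ≥ 0`, a time-zero base site, `j ≠ 0`
and `1 ≤ s, t ≤ L/2`: `G(s + t)² ≤ G(2t) · G(2s)`. -/
theorem sq_tCorr_le_odd_temporal (hL : Odd L) (hL3 : 3 ≤ L) (hρ : Continuous ρ) {β : ℝ}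
    (hβ : 0 ≤ β) {x : Site d L} (hx : x 0 = 0) {j : Fin d} (hj : j ≠ 0) {s t : ℕ} (hs1 : 1 ≤ s)
    (hs : s ≤ L / 2) (ht1 : 1 ≤ t) (ht : t ≤ L / 2) :
    (tCorr ρ β x 0 j (((s + t : ℕ) : ZMod L))) ^ 2
      ≤ tCorr ρ β x 0 j (((2 * t : ℕ) : ZMod L)) * tCorr ρ β x 0 j (((2 * s : ℕ) : ZMod L)) := by
  haveI := isProbabilityMeasure_wilsonMeasure (d := d) (L := L) ρ hρ β
  haveI : Fact (1 < L) := ⟨by omega⟩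
  set c := wilsonExpectation ρ β (tObs ρ x 0 j 0) with hc
  set adm : (GaugeConfig d L G → ℝ) → Prop := fun F => DependsOn F
    ((WilsonOddRP.oPosEdges ∪ WilsonOddRP.oSharedEdges : Finset (Edge d L)) : Set (Edge d L))
    with hadm_def
  have hadm : ∀ (A B : GaugeConfig d L G → ℝ) (r : ℝ), adm A → adm B →
      adm (fun U => A U + r * B U) :=
    fun A B r hA hB U V hUV => by simp only [hA hUV, hB hUV]
  obtain ⟨hAm, hAb, -⟩ := centred_Pobs_props_temporal ρ hρ x hj ((t : ℕ) : ZMod L) c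
  obtain ⟨hBm, hBb, -⟩ := centred_Pobs_props_temporal ρ hρ x hj ((s : ℕ) : ZMod L) c
  have key := sq_integral_mul_comp_le_of_rp (μ := wilsonMeasure ρ β) timeReflectEquiv
    (measurePreserving_timeReflectEquiv ρ hρ β)
    (fun U => (timeReflectEquiv (d := d) (L := L) (G := G)).left_inv U)
    adm hadm
    (fun F hF hFm hFb => integral_mul_timeReflect_nonneg_odd ρ hL hL3 hρ hβ hFm hFb hF)
    (dependsOn_odd_temporal ρ hL3 hρ hx hj c ht1 ht)
    (dependsOn_odd_temporal ρ hL3 hρ hx hj c hs1 hs) hAm hBm hAb hBb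
  have happ : ∀ U : GaugeConfig d L G,
      (timeReflectEquiv : GaugeConfig d L G ≃ᵐ GaugeConfig d L G) U = U.timeReflect := fun U => rfl
  simp_rw [happ] at key
  rw [integral_centred_timeReflect_temporal ρ hρ β hx hj,
    integral_centred_timeReflect_temporal ρ hρ β hx hj,
    integral_centred_timeReflect_temporal ρ hρ β hx hj] at key
  have e1 : ((t : ℕ) : ZMod L) + ((s : ℕ) : ZMod L) = (((s + t : ℕ) : ZMod L)) := by push_cast; ring
  have e2 : ((t : ℕ) : ZMod L) + ((t : ℕ) : ZMod L) = (((2 * t : ℕ) : ZMod L)) := by push_cast; ring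
  have e3 : ((s : ℕ) : ZMod L) + ((s : ℕ) : ZMod L) = (((2 * s : ℕ) : ZMod L)) := by push_cast; ring
  rw [e1, e2, e3] at key
  exact key

/-- **SITE REFLECTION, EVEN TORUS**: for ANY real `β`, a time-zero base site, `j ≠ 0` and
`s + 1, t + 1 ≤ L/2`: `G(s + t + 1)² ≤ G(2t + 1) · G(2s + 1)`. -/
theorem sq_tCorr_le_site_temporal (hL : Even L) (hρ : Continuous ρ) (β : ℝ) {x : Site d L}
    (hx : x 0 = 0) {j : Fin d} (hj : j ≠ 0) {s t : ℕ} (hs : s + 1 ≤ L / 2) (ht : t + 1 ≤ L / 2) :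
    (tCorr ρ β x 0 j (((s + t + 1 : ℕ) : ZMod L))) ^ 2
      ≤ tCorr ρ β x 0 j (((2 * t + 1 : ℕ) : ZMod L))
        * tCorr ρ β x 0 j (((2 * s + 1 : ℕ) : ZMod L)) := by
  haveI := isProbabilityMeasure_wilsonMeasure (d := d) (L := L) ρ hρ β
  haveI : Fact (1 < L) := ⟨by omega⟩
  set c := wilsonExpectation ρ β (tObs ρ x 0 j 0) with hc
  set adm : (GaugeConfig d L G → ℝ) → Prop := fun F => DependsOn F
    ((WilsonSiteRP.sitePosEdges ∪ WilsonSiteRP.sharedEdges : Finset (Edge d L)) : Set (Edge d L))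
    with hadm_def
  have hadm : ∀ (A B : GaugeConfig d L G → ℝ) (r : ℝ), adm A → adm B →
      adm (fun U => A U + r * B U) :=
    fun A B r hA hB U V hUV => by simp only [hA hUV, hB hUV]
  obtain ⟨hAm, hAb, -⟩ := centred_Pobs_props_temporal ρ hρ x hj ((t : ℕ) : ZMod L) c
  obtain ⟨hBm, hBb, -⟩ := centred_Pobs_props_temporal ρ hρ x hj ((s : ℕ) : ZMod L) c
  have key := sq_integral_mul_comp_le_of_rp (μ := wilsonMeasure ρ β) WilsonSiteRP.negReflectEquiv
    (measurePreserving_negReflectEquiv ρ hL hρ β)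
    (fun U => (WilsonSiteRP.negReflectEquiv (d := d) (L := L) (G := G)).left_inv U)
    adm hadm
    (fun F hF hFm hFb => integral_mul_negReflect_nonneg ρ hL hρ β hFm hFb hF)
    (dependsOn_site_temporal ρ hρ hx hj c ht) (dependsOn_site_temporal ρ hρ hx hj c hs)
    hAm hBm hAb hBb
  have happ : ∀ U : GaugeConfig d L G,
      (WilsonSiteRP.negReflectEquiv : GaugeConfig d L G ≃ᵐ GaugeConfig d L G) U = U.negReflect :=
    fun U => rfl
  simp_rw [happ] at key
  rw [integral_centred_negReflect_temporal ρ hρ β hx hj,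
    integral_centred_negReflect_temporal ρ hρ β hx hj,
    integral_centred_negReflect_temporal ρ hρ β hx hj] at key
  have e1 : ((t : ℕ) : ZMod L) + ((s : ℕ) : ZMod L) + 1 = (((s + t + 1 : ℕ) : ZMod L)) := by
    push_cast; ring
  have e2 : ((t : ℕ) : ZMod L) + ((t : ℕ) : ZMod L) + 1 = (((2 * t + 1 : ℕ) : ZMod L)) := by
    push_cast; ring
  have e3 : ((s : ℕ) : ZMod L) + ((s : ℕ) : ZMod L) + 1 = (((2 * s + 1 : ℕ) : ZMod L)) := by
    push_cast; ring
  rw [e1, e2, e3] at key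
  exact key

end Temporal

end Summit.Ventures.LatticeQCDFlow.Theory2.Clustering
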